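import Literature.NumberTheory.EllipticCurves.Castella2018.Section5Bookkeeping
import Literature.NumberTheory.EllipticCurves.NeronComponentDataProofs
import Literature.NumberTheory.EllipticCurves.ComplexMultiplicationDeuringLocalPlaces
import Literature.NumberTheory.EllipticCurves.TamagawaRingEquivProofs
import Literature.NumberTheory.EllipticCurves.TamagawaSubgroupProofs
import Literature.NumberTheory.EllipticCurves.TamagawaPrimesEquivProofs
import Literature.NumberTheory.EllipticCurves.TamagawaFiniteIndexProofs
import Literature.NumberTheory.EllipticCurves.QuadraticTwistPadicReduction
import Literature.NumberTheory.EllipticCurves.QuadraticTwistJInvariantProofs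
import Literature.NumberTheory.EllipticCurves.VariableChangePointsMap
import Literature.NumberTheory.EllipticCurves.NeronLocalHeightPotentialGoodReduction
import Literature.NumberTheory.EllipticCurves.NeronLocalHeightCompletion
import Literature.NumberTheory.EllipticCurves.Rank1Residual.Predicates
import Literature.NumberTheory.EllipticCurves.ModularityVersionApProofs
import Literature.NumberTheory.DiophantineGeometry.MinimalDiscriminantNormProofs
import Literature.NumberTheory.DiophantineGeometry.MinimalDiscriminantProofs
import Literature.NumberTheory.DiophantineGeometry.TateAlgorithmProofs
import Literature.NumberTheory.DiophantineGeometry.LocalReductionProofs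
import Literature.NumberTheory.QuadraticForms.PadicHilbertSymbol
import Literature.NumberTheory.QuadraticFields.KroneckerSplitting
import Mathlib.NumberTheory.RamificationInertia.Valuation
import HarnessLib

/-!
# Castella 2018 §5 — Tamagawa numbers in a quadratic base change and a quadratic twist, `p`-adically:
# DISCHARGE of the named fact `Castella2018.section5_tamagawaRelation` (Literature-side re-homing)

F. Castella, *On the `p`-part of the Birch–Swinnerton-Dyer formula for multiplicative primes*, Camb. J.
Math. 6 (2018) §5 (arXiv:1704.06608 p. 12) uses "the immediate relation
`Σ_{w∣N} c_w(E/K) = Σ_{ℓ∣N} c_ℓ(E/ℚ) + Σ_{ℓ∣N} c_ℓ(E^D/ℚ)` (see [skinner-zhang])", read `p`-adically, for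
semistable `E`; the tree vendors it as the named fact
`Literature.NumberTheory.EllipticCurves.Castella2018.section5_tamagawaRelation`
(`Castella2018/Section5Bookkeeping.lean`). That fact has been PROVED since 2026-08-2x, but Summits-side
(`Summit.BirchSwinnertonDyer.Rank1Residual.X11b.section5_tamagawaRelation_holds`, cell `b2b-bsdres`, files
`Summits/BirchSwinnertonDyer/Rank1Residual/X11b/Tamagawa{LocalLemmas,QuadraticPlaces,QuadraticBaseChange}.lean`),
where Literature cannot import it; this file RE-HOMES that proof into Literature (HOME
`run/shared/lean/pub/bsd-rank2/lit/HIDDEN-DISCHARGES.md`, promote event 10965534), so that the fact is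
discharged where it is stated. THEOREMS ONLY: no `def`, no named fact, no instance; every declaration below
is copied from the Summits files named (declaration bodies verbatim; namespace
`Summit.BirchSwinnertonDyer.Rank1Residual.X11b` ↦ `Literature.NumberTheory.EllipticCurves.Castella2018.TamagawaQuadratic`;
the cell's abbreviation `SplitsIn K ℓ` is spelled out as `((Ideal.span {(ℓ : ℤ)}).primesOver (𝓞 K)).ncard = 2`,
which is its definition), plus three borrowed lemmas (`valuation_j_le_one_of_hasGoodReductionAt` from
`…/Additive/TypeGIntegralJ.lean`; `isSquare_padic_discr_of_splitsIn`, `exists_baseChange_eq_smul_of_twist`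
from `…/X11b/CastellaErratumTwist.lean`). Authorship of the mathematics: the b2b-bsdres X11b seats; this
seat (bsd-rank2-lit GEN 14) only ports.

## Contents (as in the Summits originals)

* §0 borrowed: good reduction ⇒ `w(j) ≤ 1` (AEC VII.5.1); a split prime makes `d_K` a local square;
  twisting by a local square is a `ℚ_ℓ`-isomorphism (AEC X.5.4).
* §1 local lemmas (`TamagawaLocalLemmas`): `|j|_v = q_v^{ord_v Δ_min}` at a multiplicative place;
  **Kodaira–Néron at a finite place of a number field** (`1 ≤ c_w`, split multiplicative ⇒ `c_w = ord_w Δ_min`,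
  else `c_w ≤ 4`; AEC VII.6.1); the `p`-unit criterion `p ≥ 5`, `p ∤ ord_w(j)` ⇒ `p ∤ c_w`; `c_w(E_K) = c_v(E)`
  at a degree-one place; `c_v(E^{(d)}) = c_v(E)` for `d ∈ (ℚ_v^×)²`; primes of `𝓞 K` over `(ℓ)` vs places.
* §2 per place (`TamagawaQuadraticPlaces`): `ord_p Σ_{w ∣ v} c_w(E_K) = ord_p c_v(E) + ord_p c_v(E^{(d_K)})`
  for `[K:ℚ] = 2`, `p ≥ 5`, non-split bad primes multiplicative with `E[p]` ramified.
* §3 assembly (`TamagawaQuadraticBaseChange` §Assembly): `ord_p ∏ c(E^{(d_K)}) = ord_p ∏ c(E)`,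
  `ord_p ∏_w c_w(E/K) = ord_p ∏ c(E) + ord_p ∏ c(E^{(d_K)}) = 2·ord_p ∏ c(E)`.
* §4 `section5_tamagawaRelation_holds : Castella2018.section5_tamagawaRelation` — the DISCHARGE (its
  `Semistable` and `q ∣ d_K` hypotheses are idle, as in the Summits original).

References: [Castella2018] §5 (arXiv:1704.06608 p. 12); [Castella2018Erratum] Thm. A′; [SilvermanAEC2009]
VII.5.1, VII.6.1 (Kodaira–Néron), X.5.4; [SkinnerZhang2014] (the "immediate relation").
-/

noncomputable section

open scoped Classical NumberField

open WeierstrassCurve NumberField IsDedekindDomain IsDedekindDomain.HeightOneSpectrum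
  Literature.NumberTheory.EllipticCurves Literature.NumberTheory.EllipticCurves.Rank1Residual

namespace Literature.NumberTheory.EllipticCurves.Castella2018.TamagawaQuadratic

section BorrowedGoodJ

/-- **Good reduction forces integral `j`** (Silverman *AEC* VII.5.1 / VII.5.5, easy direction):
if `E/L` has good reduction at the finite place `w`, then `ord_w j(E) ≥ 0`, i.e. `w(j) ≤ 1`:
on the local minimal model `X` over `L_w`, `j · Δ_X = c₄(X)³` with `Δ_X` a `w`-unit and `c₄(X)`
`w`-integral.
[cite: SilvermanAEC2009, VII.5.1 (b) (a minimal equation with good reduction has v(Δ) = 0, v(c₄) ≥ 0, hence v(j) ≥ 0)] -/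
theorem valuation_j_le_one_of_hasGoodReductionAt {L : Type*} [Field L] [NumberField L]
    (E : WeierstrassCurve L) [E.IsElliptic] (w : HeightOneSpectrum (𝓞 L))
    (hgood : E.HasGoodReductionAt w) : w.valuation L E.j ≤ 1 := by
  haveI : (E.localMinimalModel w).IsElliptic := E.isElliptic_localMinimalModel w
  have hg : (E.localMinimalModel w).HasGoodReduction (w.adicCompletionIntegers L) := hgood
  haveI := hg.toIsMinimal
  set C : VariableChange (w.adicCompletion L) :=
    ((E.baseChange (w.adicCompletion L)).exists_isMinimal (w.adicCompletionIntegers L)).choose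
  have hX : E.localMinimalModel w = C • E.baseChange (w.adicCompletion L) := rfl
  have hj' : (E.localMinimalModel w).j = algebraMap L (w.adicCompletion L) E.j := by
    show (C • E.baseChange (w.adicCompletion L)).j = _
    rw [variableChange_j]
    exact E.map_j _
  -- `j · Δ_X = c₄(X)³`
  have key : (E.localMinimalModel w).j * (E.localMinimalModel w).Δ =
      (E.localMinimalModel w).c₄ ^ 3 := by
    rw [WeierstrassCurve.j, ← coe_Δ', mul_comm, ← mul_assoc, Units.mul_inv, one_mul]
  -- valuations on `L_w`
  have hc4 : (IsDiscreteValuationRing.maximalIdeal (w.adicCompletionIntegers L)).valuation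
      (w.adicCompletion L) (E.localMinimalModel w).c₄ ≤ 1 := by
    rw [← integralModel_c₄_eq (w.adicCompletionIntegers L) (E.localMinimalModel w)]
    exact valuation_le_one _ _
  have hΔ := hg.goodReduction
  have hjX : (IsDiscreteValuationRing.maximalIdeal (w.adicCompletionIntegers L)).valuation
      (w.adicCompletion L) (algebraMap L (w.adicCompletion L) E.j) ≤ 1 := by
    have h := congrArg ((IsDiscreteValuationRing.maximalIdeal (w.adicCompletionIntegers L)).valuation
      (w.adicCompletion L)) key
    rw [map_mul, hΔ, mul_one, map_pow, hj'] at h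
    rw [h]
    exact pow_le_one₀ zero_le hc4
  -- transfer to `w.valuation L`
  have hE := Literature.NumberTheory.EllipticCurves.isEquiv_valuation_maximalIdeal_valued w
  have h2 : (Valued.v : Valuation (w.adicCompletion L) (WithZero (Multiplicative ℤ)))
      (algebraMap L (w.adicCompletion L) E.j) ≤ 1 :=
    (Valuation.isEquiv_iff_val_le_one.mp hE).mp hjX
  have h3 := valuedAdicCompletion_eq_valuation' w E.j
  rw [← h3]
  exact h2


end BorrowedGoodJ

section BorrowedTwist

variable {K : Type} [Field K] [NumberField K]

/-- **A prime split in a quadratic field makes the discriminant a local square**: if `ℓ` splits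
in `K` (`[K:ℚ] = 2`) then `d_K ∈ (ℚ_ℓ^×)²` — for odd `ℓ`, `(d_K/ℓ) = 1` (decomposition law) and
Hensel; for `ℓ = 2`, `d_K ≡ 1 (mod 8)`. [folklore]
[cite: NeukirchANT1999, Ch. I (8.5) Prop. (decomposition of p in a quadratic field ↔ (d_K/p)) and Ch. II (4.6) Hensel] -/
theorem isSquare_padic_discr_of_splitsIn (h2 : Module.finrank ℚ K = 2) {ℓ : ℕ} [Fact ℓ.Prime]
    (hs : ((Ideal.span {(ℓ : ℤ)}).primesOver (𝓞 K)).ncard = 2) : IsSquare ((NumberField.discr K : ℚ) : ℚ_[ℓ]) := by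
  have hℓ : ℓ.Prime := Fact.out
  have hcast : ((NumberField.discr K : ℚ) : ℚ_[ℓ]) = ((NumberField.discr K : ℤ) : ℚ_[ℓ]) := by
    push_cast; rfl
  rw [hcast]
  by_cases hℓ2 : ℓ = 2
  · subst hℓ2
    have h8 : NumberField.discr K % 8 = 1 :=
      (Literature.NumberTheory.QuadraticFields.Quadratic.ncard_primesOver_two_eq_two_iff h2).mp hs
    exact Literature.NumberTheory.QuadraticForms.padic_isSquare_intCast_of_mod_eight rfl h8
  · have hJ : jacobiSym (NumberField.discr K) ℓ = 1 :=
      (Literature.NumberTheory.QuadraticFields.Quadratic.ncard_primesOver_eq_two_iff_jacobiSym h2 hℓ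
        hℓ2).mp hs
    -- `(d_K/ℓ) = 1`: `ℓ ∤ d_K` and `d_K` is a square mod `ℓ`, so a square in `ℚ_ℓ` (Hensel)
    have hnd : ¬ (ℓ : ℤ) ∣ NumberField.discr K := fun hdvd ↦ by
      have h0 : jacobiSym (NumberField.discr K) ℓ = 0 := by
        rw [jacobiSym.mod_left, Int.emod_eq_zero_of_dvd hdvd, jacobiSym.zero_left hℓ.one_lt]
      rw [h0] at hJ
      exact zero_ne_one hJ
    exact Literature.NumberTheory.QuadraticForms.padic_isSquare_intCast_of_isSquare_zmod hℓ2 hnd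
      (ZMod.isSquare_of_jacobiSym_eq_one hJ)

variable (W : WeierstrassCurve ℚ) [W.IsElliptic]

omit [W.IsElliptic] in
/-- **Twisting by an `ℓ`-adic square does not change the curve over `ℚ_ℓ`**: if `d` is a square
in `ℚ_ℓ` and `C • W^{(d)} = Wd`, then `Wd ⊗ ℚ_ℓ = D • (W ⊗ ℚ_ℓ)` for an explicit change of
variables `D` (Silverman, *AEC* X.5 Cor. 5.4; `exists_variableChange_smul_eq_quadraticTwist_sq`,
`map_quadraticTwist`, `VariableChange.baseChange_smul_eq`). [folklore]
[cite: SilvermanAEC2009, X.5.4 (twists by squares are isomorphic over the ground field)] -/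
theorem exists_baseChange_eq_smul_of_twist {d : ℚ} (hd : d ≠ 0) {ℓ : ℕ} [Fact ℓ.Prime]
    (hsq : IsSquare ((d : ℚ) : ℚ_[ℓ])) (Wd : WeierstrassCurve ℚ) {C : VariableChange ℚ}
    (hC : C • W.quadraticTwist d = Wd) :
    ∃ D : VariableChange ℚ_[ℓ], Wd.baseChange ℚ_[ℓ] = D • W.baseChange ℚ_[ℓ] := by
  obtain ⟨θ, hθ⟩ := hsq
  have hθ0 : θ ≠ 0 := by
    rintro rfl
    exact (Rat.cast_ne_zero.mpr hd : ((d : ℚ) : ℚ_[ℓ]) ≠ 0) (hθ.trans (mul_zero 0))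
  obtain ⟨C₁, hC₁⟩ := (W.baseChange ℚ_[ℓ]).exists_variableChange_smul_eq_quadraticTwist_sq hθ0
  have hθ' : algebraMap ℚ ℚ_[ℓ] d = θ ^ 2 := by rw [sq]; simpa using hθ
  have h1 : (W.quadraticTwist d).baseChange ℚ_[ℓ] = C₁ • W.baseChange ℚ_[ℓ] := by
    rw [hC₁, baseChange, baseChange, map_quadraticTwist, hθ']
  refine ⟨C.map (algebraMap ℚ ℚ_[ℓ]) * C₁, ?_⟩
  rw [← hC, VariableChange.baseChange_smul_eq, h1, mul_smul]

end BorrowedTwist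


section LocalJ

variable {A : Type*} [CommRing A] [IsDedekindDomain A] {K : Type*} [Field K] [Algebra A K]
  [IsFractionRing A K] (v : HeightOneSpectrum A) (X : WeierstrassCurve K) [X.IsElliptic]

/-- **`ord_v(j) = −ord_v(Δ_min)` at a place of multiplicative reduction** (Silverman, *AEC*
Prop. VII.5.1(b): the minimal equation at `v` has `v(c₄) = 0 < v(Δ)`, and `j · Δ = c₄³`), as the
exact identity `|j(X)|_v = exp(ord_v(Δ_min))` in `ℤᵐ⁰`, over the fraction field `K` of any Dedekind
domain; the reduction type is that of the chosen minimal model `X.localMinimalModel v`, `j` is read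
in `K`. [cite: SilvermanAEC2009, Prop. VII.5.1(b)] -/
theorem valuation_j_eq_exp_ordMinimalDiscriminant (h : X.HasMultiplicativeReductionAt v) :
    v.valuation K X.j = WithZero.exp (X.ordMinimalDiscriminant v : ℤ) := by
  set Ov := v.adicCompletionIntegers K
  set Kv := v.adicCompletion K
  haveI : (X.localMinimalModel v).IsElliptic := X.isElliptic_localMinimalModel v
  obtain ⟨-, hc₄m⟩ := (X.hasMultiplicativeReductionAt_iff_mem v).mp h
  have hj' : (X.localMinimalModel v).j = algebraMap K Kv X.j := by
    show ((((X.baseChange Kv).exists_isMinimal Ov).choose) • X.baseChange Kv).j = _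
    rw [variableChange_j]
    exact X.map_j _
  have hI : (X.localMinimalIntegralModel v).baseChange Kv = X.localMinimalModel v :=
    baseChange_integralModel_eq Ov _
  have key : (X.localMinimalModel v).j * (X.localMinimalModel v).Δ =
      (X.localMinimalModel v).c₄ ^ 3 := by
    rw [WeierstrassCurve.j, ← coe_Δ', mul_comm, ← mul_assoc, Units.mul_inv, one_mul]
  have hΔI : (X.localMinimalModel v).Δ = algebraMap Ov Kv (X.localMinimalIntegralModel v).Δ := by
    rw [← hI]; exact (X.localMinimalIntegralModel v).map_Δ _
  have hc₄I : (X.localMinimalModel v).c₄ = algebraMap Ov Kv (X.localMinimalIntegralModel v).c₄ := by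
    rw [← hI]; exact (X.localMinimalIntegralModel v).map_c₄ _
  have hΔ0 : (X.localMinimalIntegralModel v).Δ ≠ 0 := by
    intro h0
    have : (X.localMinimalModel v).Δ = 0 := by rw [hΔI, h0, map_zero]
    exact (X.localMinimalModel v).isUnit_Δ.ne_zero this
  obtain ⟨n, hn, hvn⟩ := HeightOneSpectrum.exists_addVal_adicCompletionIntegers_eq K v _ hΔ0
  have hord : X.ordMinimalDiscriminant v = n := by
    rw [ordMinimalDiscriminant, hn]; rfl
  have hc₄v : Valued.v (algebraMap Ov Kv (X.localMinimalIntegralModel v).c₄) = 1 := by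
    have hu : IsUnit (X.localMinimalIntegralModel v).c₄ := by
      by_contra hu
      exact hc₄m ((IsLocalRing.mem_maximalIdeal _).mpr hu)
    exact HeightOneSpectrum.adicCompletionIntegers.isUnit_iff_valued_eq_one.mp hu
  have hval := congrArg (Valued.v : Valuation Kv (WithZero (Multiplicative ℤ))) key
  rw [map_mul, map_pow, hc₄I, hc₄v, one_pow, hΔI] at hval
  have hΔv : Valued.v (algebraMap Ov Kv (X.localMinimalIntegralModel v).Δ) =
      WithZero.exp (-(n : ℤ)) := hvn
  rw [hΔv] at hval
  have hjv : Valued.v ((X.localMinimalModel v).j) = WithZero.exp (n : ℤ) := by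
    have hne : WithZero.exp (-(n : ℤ)) ≠ 0 := WithZero.exp_ne_zero
    rw [eq_comm, ← div_eq_iff hne, one_div, ← WithZero.exp_neg, neg_neg] at hval
    exact hval.symm
  rw [hord, ← HeightOneSpectrum.valuedAdicCompletion_eq_valuation' v X.j, ← hjv, hj']
  rfl

/-- `ord_v(Δ_min) > 0` at a place of multiplicative (hence bad) reduction
(`ordMinimalDiscriminant_eq_zero_iff`: it vanishes exactly at good places). [folklore]
[cite: SilvermanAEC2009, VII.5.1 (a) (good reduction ⟺ v(Δ_min) = 0)] -/
theorem ordMinimalDiscriminant_pos_of_hasMultiplicativeReductionAt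
    (h : X.HasMultiplicativeReductionAt v) : 0 < X.ordMinimalDiscriminant v := by
  rw [Nat.pos_iff_ne_zero, Ne, X.ordMinimalDiscriminant_eq_zero_iff_holds v]
  exact h.not_hasGoodReductionAt

/-- **`|j|_v > 1` (i.e. `ord_v(j) < 0`) at a place of multiplicative reduction**
(Silverman, *AEC* Prop. VII.5.1(b)). [cite: SilvermanAEC2009, Prop. VII.5.1(b)] -/
theorem one_lt_valuation_j (h : X.HasMultiplicativeReductionAt v) : 1 < v.valuation K X.j := by
  rw [valuation_j_eq_exp_ordMinimalDiscriminant v X h, ← WithZero.exp_zero, WithZero.exp_lt_exp]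
  exact_mod_cast ordMinimalDiscriminant_pos_of_hasMultiplicativeReductionAt v X h

end LocalJ

section KodairaNeron

variable {K : Type*} [Field K] [NumberField K] (X : WeierstrassCurve K) [X.IsElliptic]
  (w : HeightOneSpectrum (𝓞 K))

/-- **Kodaira–Néron at a finite place of a number field** (Silverman, *AEC* Thm. VII.6.1; *ATAEC*
Cor. IV.9.2(d), Thm. IV.9.4 and Table 4.1): for an elliptic curve `X/K` and a finite place `w`,
the local Tamagawa number `c_w = [E(K_w) : E₀(K_w)]` satisfies `1 ≤ c_w`; `c_w = ord_w(Δ_min)` if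
the reduction is split multiplicative; and `c_w ≤ 4` otherwise. Proof = the tree's proof over `ℚ`
(`kodairaNeron_tamagawaNumberAt`) at a place of `𝓞 K`: finiteness (`localTamagawaNumber_baseChange_ne_zero`),
the split case (`localTamagawaNumber_eq_ordMinimalDiscriminant_of_hasSplitMultiplicativeReductionAt`),
and otherwise the case analysis on the Kodaira symbol `X.kodairaSymbolAt w` of Tate's algorithm,
each type discharged by the corresponding local-index theorem of the `NeronComponentIndex*Proofs`
files (all stated over a Dedekind domain with finite / perfect residue field).
[cite: SilvermanAEC2009, Thm VII.6.1] -/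
theorem kodairaNeron_localTamagawaNumber :
    1 ≤ (X.baseChange (w.adicCompletion K)).localTamagawaNumber (w.adicCompletionIntegers K) ∧
      (X.HasSplitMultiplicativeReductionAt w →
        (X.baseChange (w.adicCompletion K)).localTamagawaNumber (w.adicCompletionIntegers K) =
          X.ordMinimalDiscriminant w) ∧
      (¬ X.HasSplitMultiplicativeReductionAt w →
        (X.baseChange (w.adicCompletion K)).localTamagawaNumber (w.adicCompletionIntegers K) ≤ 4) := by
  haveI : Finite (IsLocalRing.ResidueField (w.adicCompletionIntegers K)) :=
    HeightOneSpectrum.finite_residueField_adicCompletionIntegers K w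
  haveI : PerfectField (IsLocalRing.ResidueField (w.adicCompletionIntegers K)) :=
    PerfectField.ofFinite
  haveI := X.isElliptic_localMinimalModel w
  refine ⟨Nat.one_le_iff_ne_zero.mpr (X.localTamagawaNumber_baseChange_ne_zero w),
    fun hs => localTamagawaNumber_eq_ordMinimalDiscriminant_of_hasSplitMultiplicativeReductionAt
      w X hs,
    fun hns => ?_⟩
  rcases hk : X.kodairaSymbolAt w with (_ | m) | _ | _ | _ | (_ | n) | _ | _ | _
  · -- `I₀`: good reduction, `c_w = 1`
    have hg : X.HasGoodReductionAt w :=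
      (WeierstrassCurve.isGood_kodairaSymbolAt_iff_holds w X).mp hk
    rw [localTamagawaNumber_eq_one_of_good' w X
      (WeierstrassCurve.localTamagawaNumber_eq_one_of_hasGoodReduction_holds _ _) hg]
    norm_num
  · -- `Iₘ₊₁`: multiplicative, non-split by hypothesis, `c_w ∈ {1, 2}`
    obtain ⟨hmult, -⟩ :=
      (WeierstrassCurve.kodairaSymbolAt_eq_I_iff_holds w X m.succ_ne_zero).mp hk
    rw [localTamagawaNumber_of_hasNonsplitMultiplicativeReductionAt_holds w X hmult hns]
    split_ifs <;> norm_num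
  · -- `II`
    rw [localTamagawaNumber_eq_one_of_kodairaSymbolAt_eq_II_holds w X hk]
    norm_num
  · -- `III`
    rw [localTamagawaNumber_eq_two_of_kodairaSymbolAt_eq_III_holds w X hk]
    norm_num
  · -- `IV`
    rcases localTamagawaNumber_of_kodairaSymbolAt_eq_IV_holds w X hk with h | h <;> omega
  · -- `I₀*`
    rcases localTamagawaNumber_of_kodairaSymbolAt_eq_Istar_zero_holds w X hk with h | h | h <;>
      omega
  · -- `Iₙ₊₁*`
    rcases localTamagawaNumber_of_kodairaSymbolAt_eq_Istar_succ_holds w X n hk with h | h <;>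
      omega
  · -- `IV*`
    rcases localTamagawaNumber_of_kodairaSymbolAt_eq_IVstar_holds w X hk with h | h <;> omega
  · -- `III*`
    rw [localTamagawaNumber_eq_two_of_kodairaSymbolAt_eq_IIIstar_holds w X hk]
    norm_num
  · -- `II*`
    rw [localTamagawaNumber_eq_one_of_kodairaSymbolAt_eq_IIstar_holds w X hk]
    norm_num

/-- **The `p`-unit criterion for `c_w`, `p ≥ 5`** (the use of Kodaira–Néron in Castella 2018 §5,
CGLS 2022 (5.6), W. Zhang 2014: "`E[p]` ramified at a multiplicative `q` ⇒ `p ∤ c_q`", and `c ≤ 4`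
at additive places): if every positive `n` with `|j(X)|_w = exp(n)` (i.e. `ord_w(j) = −n < 0`) is
prime to `p`, then `p ∤ c_w`. For split multiplicative reduction `c_w = ord_w(Δ_min) = −ord_w(j)`
(`kodairaNeron_localTamagawaNumber`, `valuation_j_eq_exp_ordMinimalDiscriminant`); otherwise
`1 ≤ c_w ≤ 4 < p`. [cite: SilvermanAEC2009, Thm VII.6.1] -/
theorem padicValNat_localTamagawaNumber_eq_zero {p : ℕ} [Fact p.Prime] (hp : 5 ≤ p)
    (hj : ∀ n : ℕ, 0 < n → w.valuation K X.j = WithZero.exp (n : ℤ) → ¬ p ∣ n) :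
    padicValNat p
      ((X.baseChange (w.adicCompletion K)).localTamagawaNumber (w.adicCompletionIntegers K)) = 0 := by
  obtain ⟨h1, hsplit, hns⟩ := kodairaNeron_localTamagawaNumber X w
  refine padicValNat.eq_zero_of_not_dvd fun hdvd => ?_
  by_cases hs : X.HasSplitMultiplicativeReductionAt w
  · have hmult := hs.hasMultiplicativeReductionAt
    rw [hsplit hs] at hdvd
    exact hj _ (ordMinimalDiscriminant_pos_of_hasMultiplicativeReductionAt w X hmult)
      (valuation_j_eq_exp_ordMinimalDiscriminant w X hmult) hdvd
  · have h4 := hns hs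
    have hle := Nat.le_of_dvd (by omega) hdvd
    omega

end KodairaNeron

section SplitTransport

/-- **At a place of degree one the local Tamagawa number of the base change is the one below.**
For number fields `K ⊇ F`, an elliptic curve `X/F` and a finite place `w` of `K` with
`e(w|v) = f(w|v) = 1` over `v = w ∩ 𝓞 F`: `c_w(X_K) = c_v(X)`. The completions are isomorphic as
discretely valued fields compatibly with `F → K`
(`exists_ringEquiv_adicCompletion_of_ramificationIdx_eq_one_of_inertiaDeg_eq_one`), `X_K ⊗ K_w`
is the image of `X ⊗ F_v`, and `c` is invariant under such isomorphisms
(`localTamagawaNumber_map_ringEquiv`; Silverman *AEC* VII.6 Ex. 7.6). For quadratic `K/ℚ` this is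
"`c_w = c_w̄ = c_ℓ(E)` at a split `ℓ`" of Castella §5 / CGLS 2022 (5.6). [folklore]
[cite: Castella2018, §5 (arXiv:1704.06608 p. 12: "c_w = c_w̄ = c_ℓ(E)" at a split ℓ, the immediate relation)] [cite: SilvermanAEC2009, VII.6.1] -/
theorem localTamagawaNumber_baseChange_eq_of_degree_one
    {F K : Type*} [Field F] [NumberField F] [Field K] [NumberField K] [Algebra F K]
    (X : WeierstrassCurve F) [X.IsElliptic] (w : HeightOneSpectrum (𝓞 K))
    (he : w.asIdeal.ramificationIdx (𝓞 F) = 1) (hf : w.asIdeal.inertiaDeg (𝓞 F) = 1) :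
    ((X.baseChange K).baseChange (w.adicCompletion K)).localTamagawaNumber
        (w.adicCompletionIntegers K) =
      (X.baseChange ((w.under (𝓞 F)).adicCompletion F)).localTamagawaNumber
        ((w.under (𝓞 F)).adicCompletionIntegers F) := by
  set v : HeightOneSpectrum (𝓞 F) := w.under (𝓞 F) with hv
  haveI : w.asIdeal.LiesOver v.asIdeal := ⟨rfl⟩
  obtain ⟨ψ, φ, hc, hφ⟩ := Literature.NumberTheory.Automorphic.exists_ringEquiv_adicCompletion_of_ramificationIdx_eq_one_of_inertiaDeg_eq_one
    F K v w he hf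
  have hX : (X.baseChange K).baseChange (w.adicCompletion K) =
      (X.baseChange (v.adicCompletion F)).map (φ : v.adicCompletion F →+* w.adicCompletion K) := by
    simp only [baseChange, map_map]
    congr 1
    refine RingHom.ext fun x ↦ ?_
    simp only [RingHom.coe_comp, Function.comp_apply, RingHom.coe_coe]
    exact (hφ x).symm
  haveI : (X.baseChange (v.adicCompletion F)).IsElliptic := by rw [baseChange]; infer_instance
  rw [hX, localTamagawaNumber_map_ringEquiv ψ φ hc]

/-- **Twisting by a `v`-adic square does not change `c_v`** (Silverman, *AEC* X.5 Cor. 5.4 with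
VII.6 Ex. 7.6): if `d ∈ (ℚ_ℓ^×)²` for the prime `ℓ` under the place `v` of `ℚ` and
`C • W^{(d)} = Wd`, then `c_v(Wd) = c_v(W)` — both factors are the `ℚ_[ℓ]`-ones
(`localTamagawaNumber_padic_eq_holds`), `Wd ⊗ ℚ_ℓ = D • (W ⊗ ℚ_ℓ)`
(`exists_baseChange_eq_smul_of_twist`), and `c` is invariant under changes of variables
(`localTamagawaNumber_variableChange_holds`). [folklore]
[cite: SilvermanAEC2009, X.5.4 and VII.6.1] -/
theorem localTamagawaNumber_eq_of_twist_of_isSquare (W : WeierstrassCurve ℚ) [W.IsElliptic]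
    (v : HeightOneSpectrum (𝓞 ℚ)) {ℓ : ℕ} [Fact ℓ.Prime]
    (hv : (Rat.HeightOneSpectrum.primesEquiv v : ℕ) = ℓ) {d : ℚ} (hd : d ≠ 0)
    (hsq : IsSquare ((d : ℚ) : ℚ_[ℓ]))
    (Wd : WeierstrassCurve ℚ) [Wd.IsElliptic] {C : VariableChange ℚ}
    (hC : C • W.quadraticTwist d = Wd) :
    (Wd.baseChange (v.adicCompletion ℚ)).localTamagawaNumber (v.adicCompletionIntegers ℚ) =
      (W.baseChange (v.adicCompletion ℚ)).localTamagawaNumber (v.adicCompletionIntegers ℚ) := by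
  obtain ⟨D, hD⟩ := exists_baseChange_eq_smul_of_twist W hd hsq Wd hC
  haveI : (W.baseChange ℚ_[ℓ]).IsElliptic := inferInstanceAs (W.map (algebraMap ℚ ℚ_[ℓ])).IsElliptic
  rw [← localTamagawaNumber_padic_eq_holds W v ℓ hv, ← localTamagawaNumber_padic_eq_holds Wd v ℓ hv,
    hD]
  exact localTamagawaNumber_variableChange_holds (R := ℤ_[ℓ]) (W.baseChange ℚ_[ℓ]) D

end SplitTransport

section Places

variable (K : Type*) [Field K] [NumberField K]

omit [NumberField K] in
/-- A prime `𝔭 ∋ ℓ` of `𝓞 K` lies over `(ℓ) ⊂ ℤ`. [folklore] -/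
private theorem under_int_eq_span_of_mem {ℓ : ℕ} (hℓ : ℓ.Prime) (w : HeightOneSpectrum (𝓞 K))
    (hw : ((ℓ : ℤ) : 𝓞 K) ∈ w.asIdeal) : w.asIdeal.under ℤ = Ideal.span {(ℓ : ℤ)} := by
  have hpprime : (Ideal.span {(ℓ : ℤ)}).IsPrime :=
    (Ideal.span_singleton_prime (by exact_mod_cast hℓ.ne_zero)).mpr (Nat.prime_iff_prime_int.mp hℓ)
  have hp0 : Ideal.span {(ℓ : ℤ)} ≠ ⊥ := by
    rw [Ne, Ideal.span_singleton_eq_bot]; exact_mod_cast hℓ.ne_zero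
  haveI hpmax : (Ideal.span {(ℓ : ℤ)}).IsMaximal := hpprime.isMaximal hp0
  haveI := w.isPrime
  refine (hpmax.eq_of_le (Ideal.IsPrime.under ℤ w.asIdeal).ne_top fun x hx => ?_).symm
  rw [Ideal.mem_span_singleton] at hx
  obtain ⟨c, rfl⟩ := hx
  rw [Ideal.mem_comap, map_mul, eq_intCast, eq_intCast]
  exact Ideal.mul_mem_right _ _ hw

/-- **The primes of `𝓞 K` over `(ℓ) ⊂ ℤ` are the places of `K` above the place `v ↔ ℓ` of `ℚ`**
(bridge between the `ℤ`-indexed `Ideal.primesOver` of the cell's `((Ideal.span {(ℓ : ℤ)}).primesOver (𝓞 K)).ncard = 2` / Cai–Shu–Tian's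
Heegner condition and the `𝓞 ℚ`-place-indexed fibres `{w | w ∩ 𝓞 ℚ = v}` of
`placesOver_trichotomy_of_finrank_eq_two`). [folklore]
[cite: NeukirchANT1999, Ch. I §8 (primes of 𝓞_K over (p) = places of K above p)] -/
theorem primesOver_span_eq_image_setOf_under_eq (v : HeightOneSpectrum (𝓞 ℚ)) :
    (Ideal.span {((Rat.HeightOneSpectrum.primesEquiv v : ℕ) : ℤ)}).primesOver (𝓞 K) =
      HeightOneSpectrum.asIdeal '' {w : HeightOneSpectrum (𝓞 K) | w.under (𝓞 ℚ) = v} := by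
  set ℓ : ℕ := (Rat.HeightOneSpectrum.primesEquiv v : ℕ) with hℓdef
  have hℓ : ℓ.Prime := (Rat.HeightOneSpectrum.primesEquiv v).2
  have hv : v = (Rat.HeightOneSpectrum.primesEquiv (R := 𝓞 ℚ)).symm ⟨ℓ, hℓ⟩ := by
    rw [Equiv.eq_symm_apply]; exact Subtype.ext rfl
  have hℓv : (ℓ : 𝓞 ℚ) ∈ v.asIdeal :=
    (natCast_mem_asIdeal_iff_eq_primesEquiv_symm v hℓ).mpr hv
  have hp0 : Ideal.span {(ℓ : ℤ)} ≠ ⊥ := by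
    rw [Ne, Ideal.span_singleton_eq_bot]; exact_mod_cast hℓ.ne_zero
  ext Q
  simp only [Set.mem_image, Set.mem_setOf_eq]
  constructor
  · intro hQ
    haveI := hQ.1
    haveI := hQ.2
    have hQ0 : Q ≠ ⊥ := Ideal.ne_bot_of_liesOver_of_ne_bot hp0 Q
    set w : HeightOneSpectrum (𝓞 K) := ⟨Q, hQ.1, hQ0⟩
    refine ⟨w, ?_, rfl⟩
    have hℓQ : ((ℓ : ℤ) : 𝓞 K) ∈ Q := by
      have : (ℓ : ℤ) ∈ Q.under ℤ := by
        rw [← Ideal.LiesOver.over (p := Ideal.span {(ℓ : ℤ)}) (P := Q)]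
        exact Ideal.mem_span_singleton_self _
      rw [Ideal.mem_comap, eq_intCast] at this
      exact this
    have hmem : (ℓ : 𝓞 ℚ) ∈ (w.under (𝓞 ℚ)).asIdeal := by
      rw [HeightOneSpectrum.under_asIdeal, Ideal.under_def, Ideal.mem_comap, map_natCast]
      exact_mod_cast hℓQ
    rw [(natCast_mem_asIdeal_iff_eq_primesEquiv_symm _ hℓ).mp hmem, hv]
  · rintro ⟨w, hw, rfl⟩
    refine ⟨w.isPrime, ⟨?_⟩⟩
    have hmem : (ℓ : 𝓞 ℚ) ∈ (w.under (𝓞 ℚ)).asIdeal := by rw [hw]; exact hℓv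
    rw [HeightOneSpectrum.under_asIdeal, Ideal.under_def, Ideal.mem_comap, map_natCast] at hmem
    exact (under_int_eq_span_of_mem K hℓ w (by exact_mod_cast hmem)).symm

/-- The number of primes of `𝓞 K` over `(ℓ)` is the number of places of `K` above `v ↔ ℓ`.
[folklore]
[cite: NeukirchANT1999, Ch. I §8 (8.2) (number of primes over p)] -/
theorem ncard_primesOver_span_eq (v : HeightOneSpectrum (𝓞 ℚ)) :
    ((Ideal.span {((Rat.HeightOneSpectrum.primesEquiv v : ℕ) : ℤ)}).primesOver (𝓞 K)).ncard =
      {w : HeightOneSpectrum (𝓞 K) | w.under (𝓞 ℚ) = v}.ncard := by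
  rw [primesOver_span_eq_image_setOf_under_eq K v,
    Set.ncard_image_of_injective _ fun a b h => HeightOneSpectrum.ext h]

end Places




section Bridges

/-- **`ord_v(Δ_min) = ord_q(Δ_min(E))`** for a globally minimal `W/ℚ` at the place `v ↔ q`: the
place-indexed minimal-discriminant exponent of the tree (`ordMinimalDiscriminant`, through
`valuation_Δ_eq_of_isMinimalAt`) is the `q`-adic valuation of the global minimal discriminant
`minimalDiscriminantInt` (Silverman *AEC* VIII.8: a global minimal equation is minimal at every
prime). [folklore]
[cite: SilvermanAEC2009, VIII.8.1–8.2 (a global minimal Weierstrass equation is minimal at every prime; Δ_min)] -/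
theorem ordMinimalDiscriminant_eq_padicValInt (W : WeierstrassCurve ℚ) [W.IsElliptic]
    [W.IsGloballyMinimal] (v : HeightOneSpectrum (𝓞 ℚ)) {q : ℕ} [Fact q.Prime]
    (hv : (Rat.HeightOneSpectrum.primesEquiv v : ℕ) = q) :
    W.ordMinimalDiscriminant v = padicValInt q W.minimalDiscriminantInt := by
  have hgen : Rat.HeightOneSpectrum.natGenerator v = q := hv
  have h1 := valuation_Δ_eq_of_isMinimalAt_holds v W (IsGloballyMinimal.isMinimal v)
  rw [← cast_minimalDiscriminantInt W] at h1
  set n : ℤ := W.minimalDiscriminantInt with hn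
  have hn0 : n ≠ 0 := minimalDiscriminantInt_ne_zero W
  set k : ℕ := padicValInt q n with hk
  obtain ⟨u, hu⟩ : (q : ℤ) ^ k ∣ n := padicValInt_dvd n
  have hqu : ¬ (q : ℤ) ∣ u := fun h => by
    have h' : (q : ℤ) ^ (k + 1) ∣ n := by
      rw [hu, pow_succ]; exact mul_dvd_mul_left _ h
    rcases (padicValInt_dvd_iff (k + 1) n).mp h' with h0 | hle
    · exact hn0 h0
    · omega
  have hval : v.valuation ℚ (n : ℚ) = WithZero.exp (-(k : ℤ)) := by
    rw [hu]
    push_cast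
    rw [map_mul, map_pow, ← hgen, Literature.NumberTheory.GaloisRepresentations.Rat.valuation_natGenerator,
      Literature.NumberTheory.GaloisRepresentations.Rat.valuation_intCast_eq_one v (by rwa [hgen]),
      mul_one, ← WithZero.exp_nsmul]
    simp
  rw [hval, WithZero.exp_inj, neg_inj] at h1
  exact_mod_cast h1.symm

/-- **The `p`-adic ramification hypothesis ascends to `K`**: for `w ∣ v` with `0 < e(w|v) < p`, if
every `n > 0` with `|j(E)|_v = exp(n)` is prime to `p`, then so is every `n > 0` with
`|j(E_K)|_w = exp(n)` — since `|x|_w = |x|_v^{e(w|v)}` on `ℚ` (Mathlib `valuation_liesOver`) and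
`j(E_K) = j(E)`. [folklore]
[cite: NeukirchANT1999, Ch. II §8 (ramification index: the normalised valuation of w restricted to the ground field is e(w|v) times that of v)] [cite: SilvermanAEC2009, VII.5.1] -/
theorem jHyp_baseChange (W : WeierstrassCurve ℚ) [W.IsElliptic] (K : Type*) [Field K]
    [NumberField K] [(W.baseChange K).IsElliptic] (w : HeightOneSpectrum (𝓞 K))
    (v : HeightOneSpectrum (𝓞 ℚ)) (hw : w.under (𝓞 ℚ) = v)
    {p e : ℕ} (hpr : p.Prime) (he : w.asIdeal.ramificationIdx (𝓞 ℚ) = e) (he0 : 0 < e)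
    (hep : e < p)
    (H : ∀ n : ℕ, 0 < n → v.valuation ℚ W.j = WithZero.exp (n : ℤ) → ¬ p ∣ n) :
    ∀ n : ℕ, 0 < n → w.valuation K (W.baseChange K).j = WithZero.exp (n : ℤ) → ¬ p ∣ n := by
  intro n hn hval hdvd
  haveI : w.asIdeal.LiesOver v.asIdeal := ⟨by rw [← hw]; rfl⟩
  have hj : (W.baseChange K).j = algebraMap ℚ K W.j := W.map_j _
  have hlo := HeightOneSpectrum.valuation_liesOver K v w W.j
  rw [Ideal.ramificationIdx'_eq_ramificationIdx v.asIdeal w.asIdeal v.ne_bot, he, ← hj, hval] at hlo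
  have hj0 : v.valuation ℚ W.j ≠ 0 := by
    intro h0
    rw [h0, zero_pow he0.ne'] at hlo
    exact WithZero.exp_ne_zero hlo.symm
  obtain ⟨m, hm⟩ : ∃ m : ℤ, v.valuation ℚ W.j = WithZero.exp m :=
    ⟨WithZero.log (v.valuation ℚ W.j), (WithZero.exp_log hj0).symm⟩
  rw [hm, ← WithZero.exp_nsmul, WithZero.exp_inj, nsmul_eq_mul] at hlo
  have hm0 : 0 < m := by
    by_contra hle
    push Not at hle
    have : (e : ℤ) * m ≤ 0 := mul_nonpos_of_nonneg_of_nonpos (by positivity) hle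
    omega
  obtain ⟨m', rfl⟩ : ∃ m' : ℕ, m = m' := ⟨m.toNat, (Int.toNat_of_nonneg hm0.le).symm⟩
  have hm'0 : 0 < m' := by exact_mod_cast hm0
  have hn' : n = e * m' := by exact_mod_cast hlo.symm
  have hpm : ¬ p ∣ m' := H m' hm'0 hm
  rw [hn'] at hdvd
  rcases (Nat.Prime.dvd_mul hpr).mp hdvd with h | h
  · exact absurd (Nat.le_of_dvd he0 h) (by omega)
  · exact hpm h

end Bridges

section PerPlace

/-- **The Tamagawa relation, one rational place at a time.** Let `W/ℚ` be globally minimal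
elliptic, `p ≥ 5`, `K` a quadratic field (`[K:ℚ] = 2`, `d = d_K`) such that at every prime
`ℓ ∣ N_E` which does not split in `K` the reduction is multiplicative with `p ∤ ord_ℓ(Δ_min)`
(`hbad`), and `Wd = C • W^{(d_K)}` an elliptic model of the twist. Then for every finite place `v`
of `ℚ`: `Σ_{w ∣ v} ord_p c_w(E_K) = ord_p c_v(E) + ord_p c_v(E^{(d_K)})` and
`ord_p c_v(E^{(d_K)}) = ord_p c_v(E)`. Split `v`: both places above have `c_w = c_v(E)` and
`c_v(E^{(d)}) = c_v(E)`; non-split `v`: all three are `p`-units (module docstring).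
Castella 2018 §5 "immediate relation"; CGLS 2022 (5.6); JSW 2017 (eq:tamK).
[cite: Castella2018, §5 (arXiv:1704.06608 p. 12), Tamagawa relation] -/
theorem padicValNat_sum_fibre_eq (W : WeierstrassCurve ℚ) [W.IsElliptic] [W.IsGloballyMinimal]
    (p : ℕ) [Fact p.Prime] (hp : 5 ≤ p) (K : Type) [Field K] [NumberField K]
    [(W.baseChange K).IsElliptic] (h2 : Module.finrank ℚ K = 2)
    (hbad : ∀ (ℓ : ℕ) [Fact ℓ.Prime], ℓ ∣ W.conductorNorm ℤ → ¬ ((Ideal.span {(ℓ : ℤ)}).primesOver (𝓞 K)).ncard = 2 →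
      Mult W ℓ ∧ ¬ p ∣ padicValInt ℓ W.minimalDiscriminantInt)
    (Wd : WeierstrassCurve ℚ) [Wd.IsElliptic] {C : VariableChange ℚ}
    (hC : C • W.quadraticTwist (NumberField.discr K : ℚ) = Wd) (v : HeightOneSpectrum (𝓞 ℚ)) :
    (∑ w ∈ (HeightOneSpectrum.finite_setOf_under_eq_of_numberField (K := K) v).toFinset,
        padicValNat p (((W.baseChange K).baseChange (w.adicCompletion K)).localTamagawaNumber
          (w.adicCompletionIntegers K)) =
      padicValNat p ((W.baseChange (v.adicCompletion ℚ)).localTamagawaNumber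
          (v.adicCompletionIntegers ℚ)) +
        padicValNat p ((Wd.baseChange (v.adicCompletion ℚ)).localTamagawaNumber
          (v.adicCompletionIntegers ℚ))) ∧
    padicValNat p ((Wd.baseChange (v.adicCompletion ℚ)).localTamagawaNumber
        (v.adicCompletionIntegers ℚ)) =
      padicValNat p ((W.baseChange (v.adicCompletion ℚ)).localTamagawaNumber
        (v.adicCompletionIntegers ℚ)) := by
  have hpr : p.Prime := Fact.out
  set ℓ : ℕ := (Rat.HeightOneSpectrum.primesEquiv v : ℕ) with hℓdef
  haveI hℓ : Fact ℓ.Prime := ⟨(Rat.HeightOneSpectrum.primesEquiv v).2⟩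
  have hvℓ : (Rat.HeightOneSpectrum.primesEquiv v : ℕ) = ℓ := rfl
  have hd : (NumberField.discr K : ℚ) ≠ 0 := by exact_mod_cast NumberField.discr_ne_zero K
  have hfin := HeightOneSpectrum.finite_setOf_under_eq_of_numberField (K := K) v
  -- `j(Wd) = j(W)`
  have hjd : Wd.j = W.j := by
    haveI := W.isElliptic_quadraticTwist hd
    have h0 : ∀ (X : WeierstrassCurve ℚ) [X.IsElliptic],
        X = C • W.quadraticTwist (NumberField.discr K : ℚ) → X.j = W.j := by
      rintro X _ rfl
      rw [variableChange_j, j_quadraticTwist W hd]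
    exact h0 Wd hC.symm
  -- the case of a single place `w` above `v` (inert or ramified): all three numbers are `p`-units
  have key : ∀ (w : HeightOneSpectrum (𝓞 K)) (e : ℕ),
      {w' : HeightOneSpectrum (𝓞 K) | w'.under (𝓞 ℚ) = v} = {w} →
      w.asIdeal.ramificationIdx (𝓞 ℚ) = e → 0 < e → e ≤ 2 →
      (∑ w ∈ hfin.toFinset,
          padicValNat p (((W.baseChange K).baseChange (w.adicCompletion K)).localTamagawaNumber
            (w.adicCompletionIntegers K)) =
        padicValNat p ((W.baseChange (v.adicCompletion ℚ)).localTamagawaNumber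
            (v.adicCompletionIntegers ℚ)) +
          padicValNat p ((Wd.baseChange (v.adicCompletion ℚ)).localTamagawaNumber
            (v.adicCompletionIntegers ℚ))) ∧
      padicValNat p ((Wd.baseChange (v.adicCompletion ℚ)).localTamagawaNumber
          (v.adicCompletionIntegers ℚ)) =
        padicValNat p ((W.baseChange (v.adicCompletion ℚ)).localTamagawaNumber
          (v.adicCompletionIntegers ℚ)) := by
    intro w e hset he he0 he2
    have hw : w.under (𝓞 ℚ) = v := by
      have h : w ∈ ({w} : Set (HeightOneSpectrum (𝓞 K))) := Set.mem_singleton _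
      rwa [← hset] at h
    have hF : hfin.toFinset = {w} := by
      ext w'
      rw [Set.Finite.mem_toFinset, hset]
      simp
    -- `ℓ` does not split in `K`
    have hns : ¬ ((Ideal.span {(ℓ : ℤ)}).primesOver (𝓞 K)).ncard = 2 := by
      show ((Ideal.span {(ℓ : ℤ)}).primesOver (𝓞 K)).ncard ≠ 2
      rw [hℓdef, ncard_primesOver_span_eq K v, hset, Set.ncard_singleton]
      decide
    -- the `p`-adic hypothesis on `ord_v j(E)`: `E` is good at `ℓ`, or multiplicative with `p ∤ ord Δ`
    have H : ∀ n : ℕ, 0 < n → v.valuation ℚ W.j = WithZero.exp (n : ℤ) → ¬ p ∣ n := by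
      by_cases hℓN : ℓ ∣ W.conductorNorm ℤ
      · obtain ⟨hmℓ, hvℓN⟩ := hbad ℓ hℓN hns
        have hmv : W.HasMultiplicativeReductionAt v :=
          (hasMultiplicativeReductionAtPrime_primesEquiv_iff_holds W v ℓ hvℓ).mp hmℓ
        intro n hn hval
        rw [valuation_j_eq_exp_ordMinimalDiscriminant v W hmv, WithZero.exp_inj] at hval
        have hn' : n = W.ordMinimalDiscriminant v := by exact_mod_cast hval.symm
        rw [hn', ordMinimalDiscriminant_eq_padicValInt W v hvℓ]
        exact hvℓN
      · have hgood : W.HasGoodReductionAt v :=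
          (hasGoodReductionAtPrime_primesEquiv_iff_holds W v ℓ hvℓ).mp
            (by
              by_contra hbad'
              exact hℓN ((W.dvd_conductorNorm_iff_not_hasGoodReductionAtPrime ℓ).mpr hbad'))
        have hj := valuation_j_le_one_of_hasGoodReductionAt W v hgood
        intro n hn hval
        exfalso
        rw [hval, ← WithZero.exp_zero, WithZero.exp_le_exp] at hj
        omega
    have hQ := padicValNat_localTamagawaNumber_eq_zero W v hp H
    have hD := padicValNat_localTamagawaNumber_eq_zero Wd v hp (by rw [hjd]; exact H)
    have hKw := padicValNat_localTamagawaNumber_eq_zero (W.baseChange K) w hp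
      (jHyp_baseChange W K w v hw hpr he he0 (by omega) H)
    rw [hF, Finset.sum_singleton, hKw, hQ, hD]
    exact ⟨rfl, rfl⟩
  rcases placesOver_trichotomy_of_finrank_eq_two K h2 v with
    ⟨w₁, w₂, hne, hset, hef⟩ | ⟨w, hset, he, -⟩ | ⟨w, hset, he, -⟩
  · -- split: two places of degree one, and `d_K` is a square in `ℚ_ℓ`
    have hw₁ : w₁.under (𝓞 ℚ) = v := by
      have h : w₁ ∈ ({w₁, w₂} : Set (HeightOneSpectrum (𝓞 K))) := Set.mem_insert _ _
      rwa [← hset] at h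
    have hw₂ : w₂.under (𝓞 ℚ) = v := by
      have h : w₂ ∈ ({w₁, w₂} : Set (HeightOneSpectrum (𝓞 K))) :=
        Set.mem_insert_of_mem _ (Set.mem_singleton _)
      rwa [← hset] at h
    obtain ⟨he₁, hf₁⟩ := hef w₁ hw₁
    obtain ⟨he₂, hf₂⟩ := hef w₂ hw₂
    have hF : hfin.toFinset = {w₁, w₂} := by
      ext w
      rw [Set.Finite.mem_toFinset, hset]
      simp
    have hs : ((Ideal.span {(ℓ : ℤ)}).primesOver (𝓞 K)).ncard = 2 := by
      show ((Ideal.span {(ℓ : ℤ)}).primesOver (𝓞 K)).ncard = 2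
      rw [hℓdef, ncard_primesOver_span_eq K v, hset, Set.ncard_pair hne]
    have hsq := isSquare_padic_discr_of_splitsIn h2 hs
    have c₁ := localTamagawaNumber_baseChange_eq_of_degree_one W w₁ he₁ hf₁
    have c₂ := localTamagawaNumber_baseChange_eq_of_degree_one W w₂ he₂ hf₂
    rw [hw₁] at c₁
    rw [hw₂] at c₂
    rw [hF, Finset.sum_pair hne, c₁, c₂,
      localTamagawaNumber_eq_of_twist_of_isSquare W v hvℓ hd hsq Wd hC]
    exact ⟨rfl, rfl⟩
  · exact key w 1 hset he one_pos (by norm_num)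
  · exact key w 2 hset he two_pos le_rfl

end PerPlace


section Assembly

/-- `ord_p` of a finite product of non-zero naturals is the sum of the `ord_p`. [folklore] -/
private theorem padicValNat_finsetProd {ι : Type*} (p : ℕ) [Fact p.Prime] (s : Finset ι)
    (f : ι → ℕ) (hf : ∀ i ∈ s, f i ≠ 0) :
    padicValNat p (∏ i ∈ s, f i) = ∑ i ∈ s, padicValNat p (f i) := by
  classical
  induction s using Finset.induction_on with
  | empty => simp
  | insert a s ha ih =>
    rw [Finset.prod_insert ha, Finset.sum_insert ha,
      padicValNat.mul (hf a (Finset.mem_insert_self a s))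
        (Finset.prod_ne_zero_iff.mpr fun i hi => hf i (Finset.mem_insert_of_mem hi)),
      ih fun i hi => hf i (Finset.mem_insert_of_mem hi)]

variable (W : WeierstrassCurve ℚ) [W.IsElliptic] [W.IsGloballyMinimal] (p : ℕ) [Fact p.Prime]
  (K : Type) [Field K] [NumberField K] (Wd : WeierstrassCurve ℚ) [Wd.IsElliptic]

/-- **Tamagawa numbers of a quadratic twist, `p`-adically (`p ≥ 5`):
`ord_p ∏_ℓ c_ℓ(E^{(d_K)}) = ord_p ∏_ℓ c_ℓ(E)`** for `W/ℚ` globally minimal elliptic, `K` quadratic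
with the bad-prime hypothesis `hbad` of `padicValNat_sum_fibre_eq` (vacuous under the classical
Heegner hypothesis "every `ℓ ∣ N` splits"), and any elliptic model `Wd` of `E^{(d_K)}`. This is the
per-pair "decidable side condition" `htam` of the Kriz–Li 2019 / BDP descents
(`KrizLi2019/SexticTwistBSDThreeDescent`, `X11b/BDPRouteDescent`) at `p ≥ 5`, now class-wide:
Jetchev–Skinner–Wan 2017 §7.3.1 (eq:tamK). Proof: both Tamagawa products are finite products over a
common finite set of places (`mulSupport_localTamagawaNumber_finite_holds`), and place by place
`ord_p c_v(E^{(d)}) = ord_p c_v(E)`. [cite: JetchevSkinnerWan2017, §7.3.1 (eq:tamK)] -/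
theorem padicValNat_tamagawaProduct_quadraticTwist_eq (hp : 5 ≤ p) (h2 : Module.finrank ℚ K = 2)
    (hbad : ∀ (ℓ : ℕ) [Fact ℓ.Prime], ℓ ∣ W.conductorNorm ℤ → ¬ ((Ideal.span {(ℓ : ℤ)}).primesOver (𝓞 K)).ncard = 2 →
      Mult W ℓ ∧ ¬ p ∣ padicValInt ℓ W.minimalDiscriminantInt)
    (hWd : ∃ C : VariableChange ℚ, C • W.quadraticTwist (NumberField.discr K : ℚ) = Wd) :
    padicValNat p Wd.tamagawaProduct = padicValNat p W.tamagawaProduct := by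
  obtain ⟨C, hC⟩ := hWd
  haveI hEK : (W.baseChange K).IsElliptic := by rw [baseChange]; infer_instance
  set cQ : HeightOneSpectrum (𝓞 ℚ) → ℕ := fun v =>
    (W.baseChange (v.adicCompletion ℚ)).localTamagawaNumber (v.adicCompletionIntegers ℚ) with hcQ
  set cD : HeightOneSpectrum (𝓞 ℚ) → ℕ := fun v =>
    (Wd.baseChange (v.adicCompletion ℚ)).localTamagawaNumber (v.adicCompletionIntegers ℚ) with hcD
  have hfinQ : (Function.mulSupport cQ).Finite := W.mulSupport_localTamagawaNumber_finite_holds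
  have hfinD : (Function.mulSupport cD).Finite := Wd.mulSupport_localTamagawaNumber_finite_holds
  set S : Finset (HeightOneSpectrum (𝓞 ℚ)) := hfinQ.toFinset ∪ hfinD.toFinset with hS
  have hsubQ : Function.mulSupport cQ ⊆ ↑S := fun v hv => by
    rw [Finset.mem_coe, hS, Finset.mem_union]; exact Or.inl (hfinQ.mem_toFinset.mpr hv)
  have hsubD : Function.mulSupport cD ⊆ ↑S := fun v hv => by
    rw [Finset.mem_coe, hS, Finset.mem_union]; exact Or.inr (hfinD.mem_toFinset.mpr hv)
  rw [show Wd.tamagawaProduct = ∏ᶠ v, cD v from rfl, show W.tamagawaProduct = ∏ᶠ v, cQ v from rfl,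
    finprod_eq_prod_of_mulSupport_subset cD hsubD, finprod_eq_prod_of_mulSupport_subset cQ hsubQ,
    padicValNat_finsetProd p S cD fun v _ => Wd.localTamagawaNumber_baseChange_ne_zero v,
    padicValNat_finsetProd p S cQ fun v _ => W.localTamagawaNumber_baseChange_ne_zero v]
  exact Finset.sum_congr rfl fun v _ => (padicValNat_sum_fibre_eq W p hp K h2 hbad Wd hC v).2

/-- **Tamagawa numbers in a quadratic base change, `p`-adically (`p ≥ 5`):
`ord_p ∏_w c_w(E/K) = ord_p ∏_ℓ c_ℓ(E) + ord_p ∏_ℓ c_ℓ(E^{(d_K)})`** — Castella 2018 §5's "immediate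
relation" / Jetchev–Skinner–Wan 2017 (eq:tamK) / CGLS 2022 (5.6), for `W/ℚ` globally minimal
elliptic, `K` quadratic with the bad-prime hypothesis `hbad` (each non-split bad prime is
multiplicative with `E[p]` ramified; vacuous under the classical Heegner hypothesis), and any
elliptic model `Wd` of `E^{(d_K)}`. Proof: the Tamagawa product of `E_K` is a finite product over the
places of `K`, regrouped along the finite fibres of `w ↦ w ∩ ℤ` (`Finset.sum_fiberwise_of_maps_to`),
and the per-place identity `padicValNat_sum_fibre_eq`.
[cite: Castella2018, §5 (arXiv:1704.06608 p. 12), Tamagawa relation]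
[cite: JetchevSkinnerWan2017, §7.3.1 (eq:tamK)] -/
theorem padicValNat_tamagawaProduct_baseChange_quadratic (hp : 5 ≤ p)
    (h2 : Module.finrank ℚ K = 2)
    (hbad : ∀ (ℓ : ℕ) [Fact ℓ.Prime], ℓ ∣ W.conductorNorm ℤ → ¬ ((Ideal.span {(ℓ : ℤ)}).primesOver (𝓞 K)).ncard = 2 →
      Mult W ℓ ∧ ¬ p ∣ padicValInt ℓ W.minimalDiscriminantInt)
    (hWd : ∃ C : VariableChange ℚ, C • W.quadraticTwist (NumberField.discr K : ℚ) = Wd) :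
    padicValNat p (W.baseChange K).tamagawaProduct =
      padicValNat p W.tamagawaProduct + padicValNat p Wd.tamagawaProduct := by
  obtain ⟨C, hC⟩ := hWd
  haveI hEK : (W.baseChange K).IsElliptic := by rw [baseChange]; infer_instance
  -- the three local Tamagawa functions
  set cK : HeightOneSpectrum (𝓞 K) → ℕ := fun w =>
    ((W.baseChange K).baseChange (w.adicCompletion K)).localTamagawaNumber
      (w.adicCompletionIntegers K) with hcK
  set cQ : HeightOneSpectrum (𝓞 ℚ) → ℕ := fun v =>
    (W.baseChange (v.adicCompletion ℚ)).localTamagawaNumber (v.adicCompletionIntegers ℚ) with hcQ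
  set cD : HeightOneSpectrum (𝓞 ℚ) → ℕ := fun v =>
    (Wd.baseChange (v.adicCompletion ℚ)).localTamagawaNumber (v.adicCompletionIntegers ℚ) with hcD
  have hfinK : (Function.mulSupport cK).Finite :=
    (W.baseChange K).mulSupport_localTamagawaNumber_finite_holds
  have hfinQ : (Function.mulSupport cQ).Finite := W.mulSupport_localTamagawaNumber_finite_holds
  have hfinD : (Function.mulSupport cD).Finite := Wd.mulSupport_localTamagawaNumber_finite_holds
  -- fibres of `K → ℚ` on places and the finite index sets
  set F : HeightOneSpectrum (𝓞 ℚ) → Finset (HeightOneSpectrum (𝓞 K)) := fun v =>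
    (HeightOneSpectrum.finite_setOf_under_eq_of_numberField (K := K) v).toFinset with hF
  have hmemF : ∀ v w, w ∈ F v ↔ w.under (𝓞 ℚ) = v := fun v w => by
    simp [hF, Set.Finite.mem_toFinset]
  set SQ : Finset (HeightOneSpectrum (𝓞 ℚ)) :=
    hfinK.toFinset.image (fun w => w.under (𝓞 ℚ)) ∪ hfinQ.toFinset ∪ hfinD.toFinset with hSQ
  set SK : Finset (HeightOneSpectrum (𝓞 K)) := SQ.biUnion F with hSK
  have hsubK : Function.mulSupport cK ⊆ ↑SK := by
    intro w hw
    rw [Finset.mem_coe, hSK, Finset.mem_biUnion]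
    refine ⟨w.under (𝓞 ℚ), ?_, (hmemF _ _).mpr rfl⟩
    rw [hSQ, Finset.mem_union, Finset.mem_union, Finset.mem_image]
    exact Or.inl (Or.inl ⟨w, hfinK.mem_toFinset.mpr hw, rfl⟩)
  have hsubQ : Function.mulSupport cQ ⊆ ↑SQ := fun v hv => by
    rw [Finset.mem_coe, hSQ, Finset.mem_union, Finset.mem_union]
    exact Or.inl (Or.inr (hfinQ.mem_toFinset.mpr hv))
  have hsubD : Function.mulSupport cD ⊆ ↑SQ := fun v hv => by
    rw [Finset.mem_coe, hSQ, Finset.mem_union, Finset.mem_union]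
    exact Or.inr (hfinD.mem_toFinset.mpr hv)
  -- `ord_p` of the three products as sums over the index sets
  have hK' : padicValNat p (W.baseChange K).tamagawaProduct = ∑ w ∈ SK, padicValNat p (cK w) := by
    rw [show (W.baseChange K).tamagawaProduct = ∏ᶠ w, cK w from rfl,
      finprod_eq_prod_of_mulSupport_subset cK hsubK]
    exact padicValNat_finsetProd p SK cK fun w _ =>
      (W.baseChange K).localTamagawaNumber_baseChange_ne_zero w
  have hQ' : padicValNat p W.tamagawaProduct = ∑ v ∈ SQ, padicValNat p (cQ v) := by
    rw [show W.tamagawaProduct = ∏ᶠ v, cQ v from rfl,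
      finprod_eq_prod_of_mulSupport_subset cQ hsubQ]
    exact padicValNat_finsetProd p SQ cQ fun v _ => W.localTamagawaNumber_baseChange_ne_zero v
  have hD' : padicValNat p Wd.tamagawaProduct = ∑ v ∈ SQ, padicValNat p (cD v) := by
    rw [show Wd.tamagawaProduct = ∏ᶠ v, cD v from rfl,
      finprod_eq_prod_of_mulSupport_subset cD hsubD]
    exact padicValNat_finsetProd p SQ cD fun v _ => Wd.localTamagawaNumber_baseChange_ne_zero v
  -- regroup the `K`-side along the fibres
  have hmaps : ∀ w ∈ SK, w.under (𝓞 ℚ) ∈ SQ := by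
    intro w hw
    rw [hSK, Finset.mem_biUnion] at hw
    obtain ⟨v, hv, hwv⟩ := hw
    rwa [(hmemF v w).mp hwv]
  have hfib : ∀ v ∈ SQ, SK.filter (fun w => w.under (𝓞 ℚ) = v) = F v := by
    intro v hv
    ext w
    simp only [Finset.mem_filter, hmemF]
    constructor
    · exact fun h => h.2
    · intro h
      refine ⟨?_, h⟩
      rw [hSK, Finset.mem_biUnion]
      exact ⟨v, hv, (hmemF v w).mpr h⟩
  rw [hK', hQ', hD', ← Finset.sum_fiberwise_of_maps_to hmaps, ← Finset.sum_add_distrib]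
  refine Finset.sum_congr rfl fun v hv => ?_
  rw [hfib v hv]
  exact (padicValNat_sum_fibre_eq W p hp K h2 hbad Wd hC v).1

/-- **`ord_p ∏_w c_w(E/K) = 2 · ord_p ∏_ℓ c_ℓ(E)`** (`p ≥ 5`) — the two theorems above combined;
under the classical Heegner hypothesis this is Jetchev–Skinner–Wan 2017 (eq:tamK)
"`∏_w c_w(E/K) = ∏_ℓ c_ℓ(E/ℚ)²`" read `p`-adically. [cite: JetchevSkinnerWan2017, §7.3.1 (eq:tamK)] -/
theorem padicValNat_tamagawaProduct_baseChange_quadratic_eq_two_mul (hp : 5 ≤ p)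
    (h2 : Module.finrank ℚ K = 2)
    (hbad : ∀ (ℓ : ℕ) [Fact ℓ.Prime], ℓ ∣ W.conductorNorm ℤ → ¬ ((Ideal.span {(ℓ : ℤ)}).primesOver (𝓞 K)).ncard = 2 →
      Mult W ℓ ∧ ¬ p ∣ padicValInt ℓ W.minimalDiscriminantInt) :
    padicValNat p (W.baseChange K).tamagawaProduct = 2 * padicValNat p W.tamagawaProduct := by
  have hd : (NumberField.discr K : ℚ) ≠ 0 := by exact_mod_cast NumberField.discr_ne_zero K
  haveI := W.isElliptic_quadraticTwist hd
  rw [padicValNat_tamagawaProduct_baseChange_quadratic W p K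
      (W.quadraticTwist (NumberField.discr K : ℚ)) hp h2 hbad ⟨1, one_smul _ _⟩,
    padicValNat_tamagawaProduct_quadraticTwist_eq W p K (W.quadraticTwist (NumberField.discr K : ℚ))
      hp h2 hbad ⟨1, one_smul _ _⟩, two_mul]

end Assembly

end Literature.NumberTheory.EllipticCurves.Castella2018.TamagawaQuadratic

/-! ### §4. The discharge, named next to the fact (`Castella2018.section5_tamagawaRelation_holds`) -/

namespace Literature.NumberTheory.EllipticCurves.Castella2018

open TamagawaQuadratic

/-- **DISCHARGE of the named fact `Castella2018.section5_tamagawaRelation`** (Castella, Camb. J.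
Math. 6 (2018) §5, the "immediate relation" of Tamagawa numbers for semistable `E`,
`Literature/…/Castella2018/Section5Bookkeeping.lean`): it is the special case `Semistable W` (not
used), `3 < p`, `q ∣ d_K` (not used) of `padicValNat_tamagawaProduct_baseChange_quadratic`.
[cite: Castella2018, §5 (arXiv:1704.06608 p. 12), Tamagawa relation] -/
theorem section5_tamagawaRelation_holds : Castella2018.section5_tamagawaRelation := by
  intro W _ _ p q _ _ K _ _ Wd _ _ _ hp3 _ hmq hvq hKiq _ hsplit hWd
  have hp : p.Prime := Fact.out
  have hp5 : 5 ≤ p := by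
    have h4 : p ≠ 4 := by rintro rfl; exact absurd hp (by decide)
    omega
  refine padicValNat_tamagawaProduct_baseChange_quadratic W p K Wd hp5 hKiq.1
    (fun ℓ _ hℓN hns => ?_) hWd
  have hℓq : ℓ = q := by
    by_contra hne
    exact hns (hsplit ℓ Fact.out hℓN hne)
  subst hℓq
  exact ⟨hmq, hvq⟩

end Literature.NumberTheory.EllipticCurves.Castella2018

end
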